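import Summits.QuantumFields.YangMills.Theorems.BalabanUVNodesN21GappedTopPairReading13CoPHDefs
import Summits.QuantumFields.YangMills.Theorems.BalabanUVNodesN21GappedTopPair13CoPHRecord
import Summits.QuantumFields.YangMills.Theorems.BalabanUVNodesN21GappedTopReading13CoPH

/-!
# N21 (NE7c) · THE DOUBLY-GAPPED READING `crGap2₁₃VAt K₀ jcut ρ ρ′ n₁ n₂`, part 1: the level-polymorphic majorant road at the record and THE BOUND AT THE TWO SELECTED DEPTHS —
# both runs' two-collar shell masses at `(i⋆, j⋆)` are `≤ 4(2L^m)⁴(1∕(n₁+1) + 1∕(n₂+1)) ×` the runs' partition functions, (M1)-FREE (the faces of the reading: part 2 `…Faces`)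

WIDTH SEAT `pub-ymgap-dag-n21-w7` (g2), node N21 = NE7c (NOT PRINTED; NOT proved at print's fixed thresholds); lane K3⁸ `SpineGivenEndpointR13SepCoPHV`
(stmt-QuantumFields-27366, `--supports … --as helper`; COUNT-NEUTRAL).  THEOREMS ONLY (0 `def`).  Imports this seat's `…GappedTopPairReading13CoPHDefs` (the reading's
objects), `…GappedTopPair13CoPHRecord` (through it `…Count`: §Q3 `sum_topGap2ShellAt_le_majorants`, §Q4 `sum_range_majorantA_le`, `integrable_oldPiece_mul_collarB`; §R1
`sum_topClassWeight2At_eq`) and the lane owner dag-n21-d's U6 `…GappedTopReading13CoPH` (p622874; through it g9's `integrable_chi_mul_dressedSlots_of_ppSelLive`, (POS)-ζ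
`zetaOfRecord_nonneg`, dag-n19-d's E1 `sum_classWeightOfDatum₉_datumOfRecord₁₃CoPH_eq_schemeZ_of_ppSelLive`, S2's `argmin_badness_bounds`).  The READING twin of CLAIM-4,
assigned to this seat by the lane owner (dag-n21-d g12, cell bus 2026-08-28 11:14Z).

WHAT THIS FILE PROVES ([folklore] bookkeeping; every row displayed).
* §E0 the (3.3) counts along an ARBITRARY letter sequence `x : ℕ → ℝ` (collars `[x_{j+2}, x_j)`): `sum_range_collarBAt_seq_le` (`≤ 2·#Iχ`, telescoping in steps of two, NO
  sign hypothesis) and `sum_range_majorantB_seq_le` (`Σ_{j<m} ∫ Σ_s collarB_s(x_{j+2},x_j)(U,Ū)·h_s ≤ 2(2L^m)⁴·Z`; `…Count`'s `sum_range_majorantB_le` is the case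
  `x = bCutGrid … k ρ′`) — the reading's run A reads its (3.3) grid at the old level `K₀ + K − 1`, which the level-polymorphic road below treats as an arbitrary sequence.
* §E1 level-polymorphic faces at NODE 00's generality: `topGap2ShellAtLevel_nonneg ∕ _le`, `majorantA2AtLevel_nonneg ∕ majorantB2AtLevel_nonneg`.
* §E2 at the record on the live line (rows `hsel`, (H-ζ)): ★ `sum_topTerm2AtLevel_eq_schemeZ_of_liveSel` (E1 at every letter pair and level), ★★ `sum_topGap2ShellAtLevel_le_majorants_of_liveSel`
  (`Σ_s shell2_j ≤ Mᵃ_j + Mᵇ_j`), ★ `sum_range_majorantA2AtLevel_le_of_liveSel` and ★ `sum_range_majorantB2AtLevel_le_of_liveSel` (each `≤ 2(2L^m)⁴ · schemeZ … p.K t`).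
* §E3 ★★★ `gap2ShellSum_selDepths_le` — at a `CoPH`-keyed tuple on the live line, under (H-ζ), with `0 ≤ ρ_K, ρ′_K ≤ 1`, both tops' `0 ≤ ε` and both old levels' `0 ≤ δ`:
  `gap2ShellSumA₁₃ … (i⋆, j⋆) ≤ 4(2L^m)⁴(1∕(n₁+1) + 1∕(n₂+1)) · schemeZ … (K₀+K) t` AND the same for run B at `K₀+K+1`, where `i⋆ = selDepthA2₁₃ … ρ n₁ K t` and
  `j⋆ = selDepthB2₁₃ … ρ′ n₂ K t` are the two INDEPENDENT argmins (S2's `argmin_badness_bounds` twice on the majorant families, then §E2's `≤ Mᵃ + Mᵇ`).  NO anti-concentration.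

HONEST FRAMING (binding).  Bookkeeping BY NAME; NO estimate of Bałaban's; (M1)-free only at SELECTED relative letters of BOTH top-step families; the residual `ζ` ∕ (3.5), the
ℝ-side and everything below the top step NOT re-lettered (LOCATED); the K3 skeleton's `PinnedAtLive` is untouched (the lane owner's reading-generic V1 knit instantiates at
`crGap2₁₃V`); the common-refinement comparison and the core sandwich are the consumer's; no `Provisos₁₃CoPH` inhabitant claimed (K0⁷ open); NE7c NOT PRINTED ∕ NOT proved at
print's FIXED thresholds; N21 NOT discharged; K3⁸ NOT claimed; counts UNMOVED (typed 28∕28 · discharged 5∕27, A 5∕28); never a count claim.  No `sorry`, no `axiom`, no `def`, no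
`instance`, no `notation`.  One finite four-torus programme at fixed `ε` — NOT ℝ⁴, NOT OS, NOT a mass gap, NOT the Clay problem.
-/

noncomputable section

open scoped BigOperators
open Finset MeasureTheory

namespace Summit.QuantumFields.YangMills.Theorems.N21GappedTopPair13CoPH

open Literature.MathematicalPhysics.QuantumFieldTheory.Balaban1983to89
open Literature.MathematicalPhysics.QuantumFieldTheory.Balaban1983to89.T4Continuum
open Literature.MathematicalPhysics.QuantumFieldTheory.Balaban1983to89.Node00
open YMDAG.UVSplit (SpineReading₁₃CoPH keyA₁₃ keyB₁₃ runA₁₃ runB₁₃ histA₁₃ histB₁₃ histA₁₃_zero histB₁₃_zero classSet₁₃ badClass₁₃)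
open Summit.QuantumFields.YangMills.Theorems.N21StepWeightsPositivity (zetaOfRecord_nonneg)
open Summit.QuantumFields.YangMills.BalabanUVNodes.N19MGFFormAtRecordMass (sum_classWeightOfDatum₉_datumOfRecord₁₃CoPH_eq_schemeZ_of_ppSelLive)
open Summit.QuantumFields.YangMills.BalabanUVNodes.N19MGFRoadLiveSelectorTower (dressedSlotsOfDatum₉_nonneg)
open Summit.QuantumFields.YangMills.BalabanUVNodes.N19MGFFormAtRecord (wOfRecord₉_nonneg)
open Summit.QuantumFields.YangMills.Theorems.N21ShellSplitOfRecord13CoPH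

/-! ## §E0 The (3.3) counts along an arbitrary letter sequence -/

section SeqCounts

variable (F : T4Family) (N : ℕ) [NeZero N] (ϑ : Stage9Params F N) (D : FiniteEpsData F (SU N)) (g₀ : ℕ → ℝ) (os : List (ULoop F))
  (p : B12.RunParams) (g : ℕ → ℝ) (k : ℕ)

/-- **ALONG ANY LETTER SEQUENCE `x` THE (3.3) COLLARS `[x_{j+2}, x_j)`, `j < m`, COUNT EVERY χ_{k+1}-CUBE AT MOST TWICE** (telescoping in steps of two; NO sign hypothesis).
[bookkeeping] -/
theorem sum_range_collarBAt_seq_le (x : ℕ → ℝ) (m : ℕ) (s : SeqOfRecord F ϑ.ν ϑ.τ9.M g p.K k) (U : GaugeField (F.P p.K) k (SU N))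
    (V' : GaugeField (F.P p.K) (k + 1) (SU N)) :
    ∑ j ∈ Finset.range m, collarBAt F N ϑ.ν ϑ.τ9.M p g k (x (j + 2)) (x j) s U V' ≤ 2 * Fintype.card (Iχ F ϑ.ν p g k) := by
  unfold collarBAt
  rw [Finset.sum_comm]
  calc ∑ c : Iχ F ϑ.ν p g k, ∑ j ∈ Finset.range m, (bFactorAt F N ϑ.ν ϑ.τ9.M p g k (x j) s c U V' - bFactorAt F N ϑ.ν ϑ.τ9.M p g k (x (j + 2)) s c U V')
      ≤ ∑ _c : Iχ F ϑ.ν p g k, (2 : ℝ) := Finset.sum_le_sum fun c _ =>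
          sum_range_sub_shift_two_le_two (x := fun j => bFactorAt F N ϑ.ν ϑ.τ9.M p g k (x j) s c U V')
            (fun j => bFactorAt_nonneg F N ϑ.ν ϑ.τ9.M p g k _ s c U V') (fun j => bFactorAt_le_one F N ϑ.ν ϑ.τ9.M p g k _ s c U V') m
    _ = 2 * Fintype.card (Iχ F ϑ.ν p g k) := by rw [Finset.sum_const, nsmul_eq_mul, Finset.card_univ, mul_comm]

/-- ★ **THE b-MAJORANTS ALONG ANY LETTER SEQUENCE**: `Σ_{j<m} ∫ Σ_s collarB(x_{j+2},x_j)(s)(U,Ū)·h_s(U) dU ≤ 2(2L^m)⁴·Z` at the top `k + 1 = p.K` (`0 ≤ ζ` for `h ≥ 0`; NO sign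
hypothesis on the letters). [bookkeeping] -/
theorem sum_range_majorantB_seq_le (hk : k + 1 = p.K) (hζ0 : ∀ p g k s Pl Ql RS U V', 0 ≤ ϑ.ζ p g k s Pl Ql RS U V') (x : ℕ → ℝ) (m : ℕ) (t : ℝ)
    (hint : ∀ s : SeqOfRecord F ϑ.ν ϑ.τ9.M g p.K k,
      Integrable (fun U => chiSeqOfRecord F N ϑ.ν ϑ.τ9.M g p.K k s U * dressedSlotsOfDatum₉ F N ϑ D g₀ os t p g k s U) (fieldMeasure (F.P p.K) k (SU N))) :
    ∑ j ∈ Finset.range m, ∫ U, ∑ s, collarBAt F N ϑ.ν ϑ.τ9.M p g k (x (j + 2)) (x j) s U ((avOfRecord F N p.K k).avg U) *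
        (chiSeqOfRecord F N ϑ.ν ϑ.τ9.M g p.K k s U * dressedSlotsOfDatum₉ F N ϑ D g₀ os t p g k s U) ∂fieldMeasure (F.P p.K) k (SU N) ≤
      2 * (2 * (F.L : ℝ) ^ F.m) ^ 4 * ∑ s, classWeightOfDatum₉ F N ϑ D g₀ os p g k t s := by
  set avg := (avOfRecord F N p.K k).avg with havg
  set h : SeqOfRecord F ϑ.ν ϑ.τ9.M g p.K k → GaugeField (F.P p.K) k (SU N) → ℝ := fun s U =>
    chiSeqOfRecord F N ϑ.ν ϑ.τ9.M g p.K k s U * dressedSlotsOfDatum₉ F N ϑ D g₀ os t p g k s U with hh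
  set B : ℕ → SeqOfRecord F ϑ.ν ϑ.τ9.M g p.K k → GaugeField (F.P p.K) k (SU N) → GaugeField (F.P p.K) (k + 1) (SU N) → ℝ := fun j s U V' =>
    collarBAt F N ϑ.ν ϑ.τ9.M p g k (x (j + 2)) (x j) s U V' with hB
  set C : ℝ := (Fintype.card (Iχ F ϑ.ν p g k) : ℝ) with hC
  have hh0 : ∀ s U, 0 ≤ h s U := fun s U => mul_nonneg (chiSeqOfRecord_nonneg F N ϑ.ν ϑ.τ9.M g p.K k s U)
    (dressedSlotsOfDatum₉_nonneg F N ϑ D g₀ os p g (wOfRecord₉_nonneg ϑ hζ0 p g) t k s U)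
  have hBint : ∀ j s, Integrable (fun U => B j s U (avg U) * h s U) (fieldMeasure (F.P p.K) k (SU N)) := fun j s =>
    (integrable_oldPiece_mul_collarB F N ϑ D g₀ os p g k _ _ t hint s).congr (ae_of_all _ fun U => by rw [hB, hh]; ring)
  have hsumB : ∀ s U V', ∑ j ∈ Finset.range m, B j s U V' ≤ 2 * C := fun s U V' => sum_range_collarBAt_seq_le F N ϑ p g k x m s U V'
  have hC4 : C ≤ (2 * (F.L : ℝ) ^ F.m) ^ 4 := card_Iχ_top_le F ϑ.ν p g k hk
  have hZ : ∫ U, ∑ s, h s U ∂fieldMeasure (F.P p.K) k (SU N) = ∑ s, classWeightOfDatum₉ F N ϑ D g₀ os p g k t s := by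
    rw [integral_finsetSum _ fun s _ => hint s]
    rfl
  have hZ0 : 0 ≤ ∑ s, classWeightOfDatum₉ F N ϑ D g₀ os p g k t s := by
    rw [← hZ]; exact integral_nonneg fun U => Finset.sum_nonneg fun s _ => hh0 s U
  have hsumint : Integrable (fun U => ∑ s, h s U) (fieldMeasure (F.P p.K) k (SU N)) := integrable_finsetSum _ fun s _ => hint s
  calc ∑ j ∈ Finset.range m, ∫ U, ∑ s, B j s U (avg U) * h s U ∂fieldMeasure (F.P p.K) k (SU N)
      = ∫ U, ∑ j ∈ Finset.range m, ∑ s, B j s U (avg U) * h s U ∂fieldMeasure (F.P p.K) k (SU N) :=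
        (integral_finsetSum _ fun j _ => integrable_finsetSum _ fun s _ => hBint j s).symm
    _ ≤ ∫ U, (2 * C) * ∑ s, h s U ∂fieldMeasure (F.P p.K) k (SU N) :=
        integral_mono (integrable_finsetSum _ fun j _ => integrable_finsetSum _ fun s _ => hBint j s) (hsumint.const_mul (2 * C)) fun U => by
          show ∑ j ∈ Finset.range m, ∑ s, B j s U (avg U) * h s U ≤ 2 * C * ∑ s, h s U
          rw [Finset.sum_comm, Finset.mul_sum]
          refine Finset.sum_le_sum fun s _ => ?_
          rw [← Finset.sum_mul]
          exact mul_le_mul_of_nonneg_right (hsumB s U (avg U)) (hh0 s U)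
    _ = (2 * C) * ∑ s, classWeightOfDatum₉ F N ϑ D g₀ os p g k t s := by rw [integral_const_mul, hZ]
    _ ≤ 2 * (2 * (F.L : ℝ) ^ F.m) ^ 4 * ∑ s, classWeightOfDatum₉ F N ϑ D g₀ os p g k t s :=
        mul_le_mul_of_nonneg_right (by linarith) hZ0

end SeqCounts

/-! ## §E1 Level-polymorphic faces at NODE 00's generality -/

section LevelFaces

variable (F : T4Family) (N : ℕ) [NeZero N] (ϑ : Stage9Params F N) (D : FiniteEpsData F (SU N)) (g₀ : ℕ → ℝ) (os : List (ULoop F))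
  (p : B12.RunParams) (g : ℕ → ℝ)

/-- `0 ≤` the two-collar shell of a history at its own level, in the meaningful regime (rows as `topGap2ShellAt_nonneg`). [bookkeeping] -/
theorem topGap2ShellAtLevel_nonneg (hζ0 : ∀ p g k s Pl Ql RS U V', 0 ≤ ϑ.ζ p g k s Pl Ql RS U V') (hζm : ZetaMeasurable F N ϑ.ζ)
    (hζ1 : IsZetaAbsLeOne F N ϑ.ν ϑ.τ9.M ϑ.ζ) {θlo θ θhi δlo δ' δhi : ℝ} (hθlo : θlo ≤ θ) (hθhi : θ ≤ θhi) (hδlo : δlo ≤ δ') (hδhi : δ' ≤ δhi) (t : ℝ)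
    (hint : ∀ k, k < p.K → ∀ s : SeqOfRecord F ϑ.ν ϑ.τ9.M g p.K k,
      Integrable (fun U => chiSeqOfRecord F N ϑ.ν ϑ.τ9.M g p.K k s U * dressedSlotsOfDatum₉ F N ϑ D g₀ os t p g k s U) (fieldMeasure (F.P p.K) k (SU N))) :
    ∀ (j : ℕ), j = p.K → ∀ s : SeqOfRecord F ϑ.ν ϑ.τ9.M g p.K j, 0 ≤ topGap2ShellAtLevel F N ϑ D g₀ os p g θlo θ θhi δlo δ' δhi t j s
  | 0, _, _ => le_rfl
  | k + 1, hk, s' => topGap2ShellAt_nonneg F N ϑ D g₀ os p g k hk hζ0 hζm hζ1 hθlo hθhi hδlo hδhi t (hint k (by omega)) s'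

/-- the two-collar shell never exceeds the pair-lettered term (the doubly-gapped core is `≥ 0`; `0 ≤ ζ` only). [bookkeeping] -/
theorem topGap2ShellAtLevel_le (hζ0 : ∀ p g k s Pl Ql RS U V', 0 ≤ ϑ.ζ p g k s Pl Ql RS U V') (θlo θ θhi δlo δ' δhi t : ℝ) :
    ∀ (j : ℕ) (s : SeqOfRecord F ϑ.ν ϑ.τ9.M g p.K j),
      topGap2ShellAtLevel F N ϑ D g₀ os p g θlo θ θhi δlo δ' δhi t j s ≤ topTerm2AtLevel F N ϑ D g₀ os p g θ δ' t j s
  | 0, s => classWeightOfDatum₉_nonneg' F N ϑ D g₀ os p g 0 (wOfRecord₉_nonneg ϑ hζ0 p g) t s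
  | k + 1, s' => topGap2ShellAt_le_topClassWeight2At F N ϑ D g₀ os p g k hζ0 θlo θ θhi δlo δ' δhi t s'

/-- `0 ≤` the a-majorant at a level for `θlo ≤ θhi` (`0 ≤ ζ`). [bookkeeping] -/
theorem majorantA2AtLevel_nonneg (hζ0 : ∀ p g k s Pl Ql RS U V', 0 ≤ ϑ.ζ p g k s Pl Ql RS U V') {θlo θhi : ℝ} (h : θlo ≤ θhi) (t : ℝ) :
    ∀ j : ℕ, 0 ≤ majorantA2AtLevel F N ϑ D g₀ os p g θlo θhi t j
  | 0 => le_rfl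
  | k + 1 => integral_nonneg fun U => mul_nonneg (collarAt_nonneg F N ϑ.ν p g k h _) (Finset.sum_nonneg fun s _ =>
      mul_nonneg (chiSeqOfRecord_nonneg F N ϑ.ν ϑ.τ9.M g p.K k s U) (dressedSlotsOfDatum₉_nonneg F N ϑ D g₀ os p g (wOfRecord₉_nonneg ϑ hζ0 p g) t k s U))

/-- `0 ≤` the b-majorant at a level for `δlo ≤ δhi` (`0 ≤ ζ`). [bookkeeping] -/
theorem majorantB2AtLevel_nonneg (hζ0 : ∀ p g k s Pl Ql RS U V', 0 ≤ ϑ.ζ p g k s Pl Ql RS U V') {δlo δhi : ℝ} (h : δlo ≤ δhi) (t : ℝ) :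
    ∀ j : ℕ, 0 ≤ majorantB2AtLevel F N ϑ D g₀ os p g δlo δhi t j
  | 0 => le_rfl
  | k + 1 => integral_nonneg fun U => Finset.sum_nonneg fun s _ => mul_nonneg (collarBAt_nonneg F N ϑ.ν ϑ.τ9.M p g k h s U _)
      (mul_nonneg (chiSeqOfRecord_nonneg F N ϑ.ν ϑ.τ9.M g p.K k s U) (dressedSlotsOfDatum₉_nonneg F N ϑ D g₀ os p g (wOfRecord₉_nonneg ϑ hζ0 p g) t k s U))

end LevelFaces

/-! ## §E2 At the `CoPH`-keyed record on the live-selector line: E1 at every letter pair, the majorant road, level-polymorphic -/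

section LevelLive2

variable {F : T4Family} {N : ℕ} [NeZero N]

/-- ★ **E1 FOR THE PAIR-LETTERED TERMS AT EVERY LEVEL AND LETTER PAIR** on the live-selector line (`j = p.K`): level `0` = dag-n19-d's E1 at level `0`; level `k+1` = §R1's
`sum_topClassWeight2At_eq` + E1 at level `k`. [bookkeeping] -/
theorem sum_topTerm2AtLevel_eq_schemeZ_of_liveSel (θ : Stage13HParams F N) (hP : θ.Provisos₁₃CoPH F N) (E : B12.RunParams → ℝ)
    (hsel : θ.ppSel = ppSelLiveOfRecord F N θ.ν θ.τ9 E (wOfRecord₉ F N θ.toStage9Params)) (hζm : ZetaMeasurable F N θ.ζ) (g₀ : ℕ → ℝ) (os : List (ULoop F))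
    {p : B12.RunParams} {g : ℕ → ℝ} (hg : g 0 = g₀ p.K) (θtop δtop t : ℝ) :
    ∀ j : ℕ, j = p.K → ∑ s, topTerm2AtLevel F N θ.toStage9Params (datumOfRecord₁₃CoPH F N θ hP) g₀ os p g θtop δtop t j s =
      T4GenFunBounds.schemeZ ((datumOfRecord₁₃CoPH F N θ hP).scheme g₀) os p.K t := by
  have hζ0 : ∀ p g k s Pl Ql RS U V', 0 ≤ θ.ζ p g k s Pl Ql RS U V' :=
    fun p g k s Pl Ql RS U V' => zetaOfRecord_nonneg F N θ.ν θ.τ9.M hP.zetaUnity hP.zetaAbs p g k s Pl Ql RS U V'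
  have hU : LocalBgMeasurable F N θ.ν := localBgMeasurable F N θ.ν
  have hD : (datumOfRecord₁₃CoPH F N θ hP).AvgMeasurable := (isPrintedAveraged_datumOfRecord₁₃CoPH F N θ hP).avgMeasurable
  intro j hj
  cases j with
  | zero =>
    simp only [topTerm2AtLevel_zero]
    exact sum_classWeightOfDatum₉_datumOfRecord₁₃CoPH_eq_schemeZ_of_ppSelLive θ hP E hsel hU hζm hζ0 g₀ os hg t 0 (Nat.zero_le _)
  | succ k =>
    simp only [topTerm2AtLevel_succ]
    rw [sum_topClassWeight2At_eq F N θ.toStage9Params (datumOfRecord₁₃CoPH F N θ hP) g₀ os p g k hj hζm hP.zetaAbs hP.zetaUnity θtop δtop t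
      (fun s => integrable_chi_mul_dressedSlots_of_ppSelLive θ.toStage9Params E hsel hU hζm hζ0 hP.zetaAbs _ hD g₀ os hg t k s)]
    exact sum_classWeightOfDatum₉_datumOfRecord₁₃CoPH_eq_schemeZ_of_ppSelLive θ hP E hsel hU hζm hζ0 g₀ os hg t k (by omega)

/-- ★★ **THE TWO-COLLAR SHELLS SUMMED OVER THE TOP HISTORIES ARE BELOW THE a-MAJORANT PLUS THE b-MAJORANT, AT EVERY LEVEL** (`j = p.K`; `θlo ≤ θ ≤ θhi`, `δlo ≤ δ′ ≤ δhi`) on the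
live-selector line: level `0`: `0 ≤ 0 + 0`; level `k+1`: §Q3 `sum_topGap2ShellAt_le_majorants`. [bookkeeping] -/
theorem sum_topGap2ShellAtLevel_le_majorants_of_liveSel (θ : Stage13HParams F N) (hP : θ.Provisos₁₃CoPH F N) (E : B12.RunParams → ℝ)
    (hsel : θ.ppSel = ppSelLiveOfRecord F N θ.ν θ.τ9 E (wOfRecord₉ F N θ.toStage9Params)) (hζm : ZetaMeasurable F N θ.ζ) (g₀ : ℕ → ℝ) (os : List (ULoop F))
    {p : B12.RunParams} {g : ℕ → ℝ} (hg : g 0 = g₀ p.K) {θlo θm θhi δlo δm δhi : ℝ} (hθlo : θlo ≤ θm) (hθhi : θm ≤ θhi) (hδlo : δlo ≤ δm) (hδhi : δm ≤ δhi)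
    (t : ℝ) :
    ∀ j : ℕ, j = p.K → ∑ s, topGap2ShellAtLevel F N θ.toStage9Params (datumOfRecord₁₃CoPH F N θ hP) g₀ os p g θlo θm θhi δlo δm δhi t j s ≤
      majorantA2AtLevel F N θ.toStage9Params (datumOfRecord₁₃CoPH F N θ hP) g₀ os p g θlo θhi t j +
        majorantB2AtLevel F N θ.toStage9Params (datumOfRecord₁₃CoPH F N θ hP) g₀ os p g δlo δhi t j := by
  have hζ0 : ∀ p g k s Pl Ql RS U V', 0 ≤ θ.ζ p g k s Pl Ql RS U V' :=
    fun p g k s Pl Ql RS U V' => zetaOfRecord_nonneg F N θ.ν θ.τ9.M hP.zetaUnity hP.zetaAbs p g k s Pl Ql RS U V'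
  have hU : LocalBgMeasurable F N θ.ν := localBgMeasurable F N θ.ν
  have hD : (datumOfRecord₁₃CoPH F N θ hP).AvgMeasurable := (isPrintedAveraged_datumOfRecord₁₃CoPH F N θ hP).avgMeasurable
  intro j hj
  cases j with
  | zero => simp
  | succ k =>
    simp only [topGap2ShellAtLevel_succ, majorantA2AtLevel_succ, majorantB2AtLevel_succ]
    exact sum_topGap2ShellAt_le_majorants F N θ.toStage9Params (datumOfRecord₁₃CoPH F N θ hP) g₀ os p g k hj hζ0 hζm hP.zetaAbs hP.zetaUnity hθlo hθhi hδlo hδhi t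
      (fun s => integrable_chi_mul_dressedSlots_of_ppSelLive θ.toStage9Params E hsel hU hζm hζ0 hP.zetaAbs _ hD g₀ os hg t k s)

/-- ★ **THE a-MAJORANTS ALONG THE (3.2) GRID OF THE TOP, AGAINST THE PARTITION FUNCTION** (`j = p.K`): `Σ_{i<m} Mᵃ_j(θ_{i+2}, θ_i) ≤ 2(2L^m)⁴ · schemeZ … p.K t` — level `0`:
`0 ≤ …`; level `k+1`: §Q4's `sum_range_majorantA_le` + dag-n19-d's E1 at level `k`. NO sign hypothesis on the letters. [bookkeeping] -/
theorem sum_range_majorantA2AtLevel_le_of_liveSel (θ : Stage13HParams F N) (hP : θ.Provisos₁₃CoPH F N) (E : B12.RunParams → ℝ)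
    (hsel : θ.ppSel = ppSelLiveOfRecord F N θ.ν θ.τ9 E (wOfRecord₉ F N θ.toStage9Params)) (hζm : ZetaMeasurable F N θ.ζ) (g₀ : ℕ → ℝ) (os : List (ULoop F))
    {p : B12.RunParams} {g : ℕ → ℝ} (hg : g 0 = g₀ p.K) (ρ : ℝ) (m : ℕ) (t : ℝ) :
    ∀ j : ℕ, j = p.K → ∑ i ∈ Finset.range m, majorantA2AtLevel F N θ.toStage9Params (datumOfRecord₁₃CoPH F N θ hP) g₀ os p g
        (cutGrid θ.ν g j ρ (i + 2)) (cutGrid θ.ν g j ρ i) t j ≤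
      2 * (2 * (F.L : ℝ) ^ F.m) ^ 4 * T4GenFunBounds.schemeZ ((datumOfRecord₁₃CoPH F N θ hP).scheme g₀) os p.K t := by
  have hζ0 : ∀ p g k s Pl Ql RS U V', 0 ≤ θ.ζ p g k s Pl Ql RS U V' :=
    fun p g k s Pl Ql RS U V' => zetaOfRecord_nonneg F N θ.ν θ.τ9.M hP.zetaUnity hP.zetaAbs p g k s Pl Ql RS U V'
  have hU : LocalBgMeasurable F N θ.ν := localBgMeasurable F N θ.ν
  have hD : (datumOfRecord₁₃CoPH F N θ hP).AvgMeasurable := (isPrintedAveraged_datumOfRecord₁₃CoPH F N θ hP).avgMeasurable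
  have hZ0 : 0 ≤ T4GenFunBounds.schemeZ ((datumOfRecord₁₃CoPH F N θ hP).scheme g₀) os p.K t := by
    rw [← sum_classWeightOfDatum₉_datumOfRecord₁₃CoPH_eq_schemeZ_of_ppSelLive θ hP E hsel hU hζm hζ0 g₀ os hg t 0 (Nat.zero_le _)]
    exact Finset.sum_nonneg fun s _ => classWeightOfDatum₉_nonneg' F N θ.toStage9Params (datumOfRecord₁₃CoPH F N θ hP) g₀ os p g 0
      (wOfRecord₉_nonneg θ.toStage9Params hζ0 p g) t s
  intro j hj
  cases j with
  | zero =>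
    simp only [majorantA2AtLevel_zero, Finset.sum_const_zero]
    exact mul_nonneg (by positivity) hZ0
  | succ k =>
    simp only [majorantA2AtLevel_succ]
    rw [← sum_classWeightOfDatum₉_datumOfRecord₁₃CoPH_eq_schemeZ_of_ppSelLive θ hP E hsel hU hζm hζ0 g₀ os hg t k (by omega)]
    exact sum_range_majorantA_le F N θ.toStage9Params (datumOfRecord₁₃CoPH F N θ hP) g₀ os p g k hj hζ0 ρ m t
      (fun s => integrable_chi_mul_dressedSlots_of_ppSelLive θ.toStage9Params E hsel hU hζm hζ0 hP.zetaAbs _ hD g₀ os hg t k s)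

/-- ★ **THE b-MAJORANTS ALONG ANY (3.3) LETTER SEQUENCE `x`, AGAINST THE PARTITION FUNCTION** (`j = p.K`): `Σ_{j′<m} Mᵇ_j(x_{j′+2}, x_{j′}) ≤ 2(2L^m)⁴ · schemeZ … p.K t` — level
`0`: `0 ≤ …`; level `k+1`: §E0's `sum_range_majorantB_seq_le` + E1 at level `k`. NO sign hypothesis on the letters. [bookkeeping] -/
theorem sum_range_majorantB2AtLevel_le_of_liveSel (θ : Stage13HParams F N) (hP : θ.Provisos₁₃CoPH F N) (E : B12.RunParams → ℝ)
    (hsel : θ.ppSel = ppSelLiveOfRecord F N θ.ν θ.τ9 E (wOfRecord₉ F N θ.toStage9Params)) (hζm : ZetaMeasurable F N θ.ζ) (g₀ : ℕ → ℝ) (os : List (ULoop F))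
    {p : B12.RunParams} {g : ℕ → ℝ} (hg : g 0 = g₀ p.K) (x : ℕ → ℝ) (m : ℕ) (t : ℝ) :
    ∀ j : ℕ, j = p.K → ∑ j' ∈ Finset.range m, majorantB2AtLevel F N θ.toStage9Params (datumOfRecord₁₃CoPH F N θ hP) g₀ os p g
        (x (j' + 2)) (x j') t j ≤
      2 * (2 * (F.L : ℝ) ^ F.m) ^ 4 * T4GenFunBounds.schemeZ ((datumOfRecord₁₃CoPH F N θ hP).scheme g₀) os p.K t := by
  have hζ0 : ∀ p g k s Pl Ql RS U V', 0 ≤ θ.ζ p g k s Pl Ql RS U V' :=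
    fun p g k s Pl Ql RS U V' => zetaOfRecord_nonneg F N θ.ν θ.τ9.M hP.zetaUnity hP.zetaAbs p g k s Pl Ql RS U V'
  have hU : LocalBgMeasurable F N θ.ν := localBgMeasurable F N θ.ν
  have hD : (datumOfRecord₁₃CoPH F N θ hP).AvgMeasurable := (isPrintedAveraged_datumOfRecord₁₃CoPH F N θ hP).avgMeasurable
  have hZ0 : 0 ≤ T4GenFunBounds.schemeZ ((datumOfRecord₁₃CoPH F N θ hP).scheme g₀) os p.K t := by
    rw [← sum_classWeightOfDatum₉_datumOfRecord₁₃CoPH_eq_schemeZ_of_ppSelLive θ hP E hsel hU hζm hζ0 g₀ os hg t 0 (Nat.zero_le _)]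
    exact Finset.sum_nonneg fun s _ => classWeightOfDatum₉_nonneg' F N θ.toStage9Params (datumOfRecord₁₃CoPH F N θ hP) g₀ os p g 0
      (wOfRecord₉_nonneg θ.toStage9Params hζ0 p g) t s
  intro j hj
  cases j with
  | zero =>
    simp only [majorantB2AtLevel_zero, Finset.sum_const_zero]
    exact mul_nonneg (by positivity) hZ0
  | succ k =>
    simp only [majorantB2AtLevel_succ]
    rw [← sum_classWeightOfDatum₉_datumOfRecord₁₃CoPH_eq_schemeZ_of_ppSelLive θ hP E hsel hU hζm hζ0 g₀ os hg t k (by omega)]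
    exact sum_range_majorantB_seq_le F N θ.toStage9Params (datumOfRecord₁₃CoPH F N θ hP) g₀ os p g k hj hζ0 x m t
      (fun s => integrable_chi_mul_dressedSlots_of_ppSelLive θ.toStage9Params E hsel hU hζm hζ0 hP.zetaAbs _ hD g₀ os hg t k s)

end LevelLive2

/-! ## §E3 At the doubly-gapped reading: the bound at the two SEPARATELY selected depths -/

section AtReading2

variable {F : T4Family} {N : ℕ} [NeZero N]

/-- ★★★ **BOTH RUNS' TWO-COLLAR SHELL MASSES AT THE SELECTED DEPTH PAIR `(i⋆, j⋆)` ARE `≤ 4(2L^m)⁴(1∕(n₁+1) + 1∕(n₂+1)) ×` THE RUNS' PARTITION FUNCTIONS** — S2's `argmin_badness_bounds`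
on the two runs' a-majorants (common `i⋆ = selDepthA2₁₃`) and, INDEPENDENTLY, on their b-majorants (common `j⋆ = selDepthB2₁₃`), then §E2's `Σ shell2 ≤ Mᵃ + Mᵇ` in each run.
Rows: `hsel`, (H-ζ), `0 ≤ ρ_K, ρ′_K ≤ 1`, both tops' `0 ≤ ε`, both old levels' `0 ≤ δ` (the a-grid of the top `K₀+K` ∕ `K₀+K+1` and the b-grid of the old level `K₀+K−1` ∕ `K₀+K`
must be monotone for the selected collars to be meaningful); NO anti-concentration, NO estimate of Bałaban's. [bookkeeping] -/
theorem gap2ShellSum_selDepths_le (K₀ : ℕ) (θ : Stage13HParams F N) (hP : θ.Provisos₁₃CoPH F N) (g₀ : ℕ → ℝ) (os : List (ULoop F)) (E : B12.RunParams → ℝ)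
    (hsel : θ.ppSel = ppSelLiveOfRecord F N θ.ν θ.τ9 E (wOfRecord₉ F N θ.toStage9Params)) (hζm : ZetaMeasurable F N θ.ζ)
    {ρ ρ' : ℕ → ℝ} (hρ0 : ∀ K, 0 ≤ ρ K) (hρ1 : ∀ K, ρ K ≤ 1) (hρ'0 : ∀ K, 0 ≤ ρ' K) (hρ'1 : ∀ K, ρ' K ≤ 1) (n₁ n₂ K : ℕ) (t : ℝ)
    (hεA : 0 ≤ epsOfRecord θ.ν (histA₁₃ θ K₀ g₀ K) (K₀ + K)) (hεB : 0 ≤ epsOfRecord θ.ν (histB₁₃ θ K₀ g₀ K) (K₀ + K + 1))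
    (hδA : 0 ≤ deltaOfRecord θ.ν (histA₁₃ θ K₀ g₀ K) (K₀ + K - 1) θ.A₁) (hδB : 0 ≤ deltaOfRecord θ.ν (histB₁₃ θ K₀ g₀ K) (K₀ + K) θ.A₁) :
    gap2ShellSumA₁₃ θ hP K₀ g₀ os ρ ρ' K (selDepthA2₁₃ θ hP K₀ g₀ os ρ n₁ K t) (selDepthB2₁₃ θ hP K₀ g₀ os ρ' n₂ K t) t ≤
        4 * (2 * (F.L : ℝ) ^ F.m) ^ 4 * (1 / (n₁ + 1 : ℕ) + 1 / (n₂ + 1 : ℕ)) * T4GenFunBounds.schemeZ ((datumOfRecord₁₃CoPH F N θ hP).scheme g₀) os (K₀ + K) t ∧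
      gap2ShellSumB₁₃ θ hP K₀ g₀ os ρ ρ' K (selDepthA2₁₃ θ hP K₀ g₀ os ρ n₁ K t) (selDepthB2₁₃ θ hP K₀ g₀ os ρ' n₂ K t) t ≤
        4 * (2 * (F.L : ℝ) ^ F.m) ^ 4 * (1 / (n₁ + 1 : ℕ) + 1 / (n₂ + 1 : ℕ)) *
          T4GenFunBounds.schemeZ ((datumOfRecord₁₃CoPH F N θ hP).scheme g₀) os (K₀ + K + 1) t := by
  have hζ0 : ∀ p g k s Pl Ql RS U V', 0 ≤ θ.ζ p g k s Pl Ql RS U V' :=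
    fun p g k s Pl Ql RS U V' => zetaOfRecord_nonneg F N θ.ν θ.τ9.M hP.zetaUnity hP.zetaAbs p g k s Pl Ql RS U V'
  have hU : LocalBgMeasurable F N θ.ν := localBgMeasurable F N θ.ν
  set X : ℝ := (2 * (F.L : ℝ) ^ F.m) ^ 4 with hX
  set ZA : ℝ := T4GenFunBounds.schemeZ ((datumOfRecord₁₃CoPH F N θ hP).scheme g₀) os (K₀ + K) t with hZA
  set ZB : ℝ := T4GenFunBounds.schemeZ ((datumOfRecord₁₃CoPH F N θ hP).scheme g₀) os (K₀ + K + 1) t with hZB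
  set i := selDepthA2₁₃ θ hP K₀ g₀ os ρ n₁ K t with hi
  set j := selDepthB2₁₃ θ hP K₀ g₀ os ρ' n₂ K t with hj
  -- the two partition functions are nonnegative (E1 at level 0)
  have hZ : ∀ (p : B12.RunParams) (g : ℕ → ℝ), g 0 = g₀ p.K → 0 ≤ T4GenFunBounds.schemeZ ((datumOfRecord₁₃CoPH F N θ hP).scheme g₀) os p.K t := by
    intro p g hg
    rw [← sum_classWeightOfDatum₉_datumOfRecord₁₃CoPH_eq_schemeZ_of_ppSelLive θ hP E hsel hU hζm hζ0 g₀ os hg t 0 (Nat.zero_le _)]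
    exact Finset.sum_nonneg fun s _ => classWeightOfDatum₉_nonneg' F N θ.toStage9Params (datumOfRecord₁₃CoPH F N θ hP) g₀ os p g 0
      (wOfRecord₉_nonneg θ.toStage9Params hζ0 p g) t s
  have hZA0 : 0 ≤ ZA := hZ (runA₁₃ F K₀ g₀ K) _ (histA₁₃_zero θ K₀ g₀ K)
  have hZB0 : 0 ≤ ZB := hZ (runB₁₃ F K₀ g₀ K) _ (histB₁₃_zero θ K₀ g₀ K)
  -- monotone grids
  have hθA : ∀ i, cutGrid θ.ν (histA₁₃ θ K₀ g₀ K) (K₀ + K) (ρ K) (i + 1) ≤ cutGrid θ.ν (histA₁₃ θ K₀ g₀ K) (K₀ + K) (ρ K) i :=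
    fun i => cutGrid_succ_le_of_nonneg θ.ν (K₀ + K) hεA (hρ0 K) (hρ1 K) i
  have hθB : ∀ i, cutGrid θ.ν (histB₁₃ θ K₀ g₀ K) (K₀ + K + 1) (ρ K) (i + 1) ≤ cutGrid θ.ν (histB₁₃ θ K₀ g₀ K) (K₀ + K + 1) (ρ K) i :=
    fun i => cutGrid_succ_le_of_nonneg θ.ν (K₀ + K + 1) hεB (hρ0 K) (hρ1 K) i
  have hδ'A : ∀ j, bCutGrid θ.ν θ.A₁ (histA₁₃ θ K₀ g₀ K) (K₀ + K - 1) (ρ' K) (j + 1) ≤ bCutGrid θ.ν θ.A₁ (histA₁₃ θ K₀ g₀ K) (K₀ + K - 1) (ρ' K) j :=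
    fun j => bCutGrid_succ_le_of_nonneg θ.ν θ.A₁ (histA₁₃ θ K₀ g₀ K) (K₀ + K - 1) hδA (hρ'0 K) (hρ'1 K) j
  have hδ'B : ∀ j, bCutGrid θ.ν θ.A₁ (histB₁₃ θ K₀ g₀ K) (K₀ + K) (ρ' K) (j + 1) ≤ bCutGrid θ.ν θ.A₁ (histB₁₃ θ K₀ g₀ K) (K₀ + K) (ρ' K) j :=
    fun j => bCutGrid_succ_le_of_nonneg θ.ν θ.A₁ (histB₁₃ θ K₀ g₀ K) (K₀ + K) hδB (hρ'0 K) (hρ'1 K) j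
  -- the four majorant families, their signs and counts
  have hfaA0 : ∀ i, 0 ≤ majA2SumA₁₃ θ hP K₀ g₀ os ρ K i t := fun i =>
    majorantA2AtLevel_nonneg F N θ.toStage9Params (datumOfRecord₁₃CoPH F N θ hP) g₀ os _ _ hζ0 ((hθA (i + 1)).trans (hθA i)) t _
  have hfaB0 : ∀ i, 0 ≤ majA2SumB₁₃ θ hP K₀ g₀ os ρ K i t := fun i =>
    majorantA2AtLevel_nonneg F N θ.toStage9Params (datumOfRecord₁₃CoPH F N θ hP) g₀ os _ _ hζ0 ((hθB (i + 1)).trans (hθB i)) t _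
  have hfbA0 : ∀ j, 0 ≤ majB2SumA₁₃ θ hP K₀ g₀ os ρ' K j t := fun j =>
    majorantB2AtLevel_nonneg F N θ.toStage9Params (datumOfRecord₁₃CoPH F N θ hP) g₀ os _ _ hζ0 ((hδ'A (j + 1)).trans (hδ'A j)) t _
  have hfbB0 : ∀ j, 0 ≤ majB2SumB₁₃ θ hP K₀ g₀ os ρ' K j t := fun j =>
    majorantB2AtLevel_nonneg F N θ.toStage9Params (datumOfRecord₁₃CoPH F N θ hP) g₀ os _ _ hζ0 ((hδ'B (j + 1)).trans (hδ'B j)) t _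
  have hsaA : ∑ i ∈ Finset.range (n₁ + 1), majA2SumA₁₃ θ hP K₀ g₀ os ρ K i t ≤ 2 * X * ZA := by
    have h := sum_range_majorantA2AtLevel_le_of_liveSel θ hP E hsel hζm g₀ os (p := runA₁₃ F K₀ g₀ K) (histA₁₃_zero θ K₀ g₀ K) (ρ K) (n₁ + 1) t (K₀ + K) rfl
    rw [YMDAG.UVSplit.runA₁₃_K] at h; exact h
  have hsaB : ∑ i ∈ Finset.range (n₁ + 1), majA2SumB₁₃ θ hP K₀ g₀ os ρ K i t ≤ 2 * X * ZB := by
    have h := sum_range_majorantA2AtLevel_le_of_liveSel θ hP E hsel hζm g₀ os (p := runB₁₃ F K₀ g₀ K) (histB₁₃_zero θ K₀ g₀ K) (ρ K) (n₁ + 1) t (K₀ + K + 1) rfl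
    rw [YMDAG.UVSplit.runB₁₃_K] at h; exact h
  have hsbA : ∑ j ∈ Finset.range (n₂ + 1), majB2SumA₁₃ θ hP K₀ g₀ os ρ' K j t ≤ 2 * X * ZA := by
    have h := sum_range_majorantB2AtLevel_le_of_liveSel θ hP E hsel hζm g₀ os (p := runA₁₃ F K₀ g₀ K) (histA₁₃_zero θ K₀ g₀ K)
      (bCutGrid θ.ν θ.A₁ (histA₁₃ θ K₀ g₀ K) (K₀ + K - 1) (ρ' K)) (n₂ + 1) t (K₀ + K) rfl
    rw [YMDAG.UVSplit.runA₁₃_K] at h; exact h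
  have hsbB : ∑ j ∈ Finset.range (n₂ + 1), majB2SumB₁₃ θ hP K₀ g₀ os ρ' K j t ≤ 2 * X * ZB := by
    have h := sum_range_majorantB2AtLevel_le_of_liveSel θ hP E hsel hζm g₀ os (p := runB₁₃ F K₀ g₀ K) (histB₁₃_zero θ K₀ g₀ K)
      (bCutGrid θ.ν θ.A₁ (histB₁₃ θ K₀ g₀ K) (K₀ + K) (ρ' K)) (n₂ + 1) t (K₀ + K + 1) rfl
    rw [YMDAG.UVSplit.runB₁₃_K] at h; exact h
  -- the two argmins
  have hspecA := selDepthA2₁₃_spec θ hP K₀ g₀ os ρ n₁ K t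
  have hspecB := selDepthB2₁₃_spec θ hP K₀ g₀ os ρ' n₂ K t
  obtain ⟨haA, haB⟩ := argmin_badness_bounds (f := fun i => majA2SumA₁₃ θ hP K₀ g₀ os ρ K i t) (g := fun i => majA2SumB₁₃ θ hP K₀ g₀ os ρ K i t)
    hfaA0 hfaB0 hZA0 hZB0 (by positivity) hsaA hsaB hspecA.1 hspecA.2
  obtain ⟨hbA, hbB⟩ := argmin_badness_bounds (f := fun j => majB2SumA₁₃ θ hP K₀ g₀ os ρ' K j t) (g := fun j => majB2SumB₁₃ θ hP K₀ g₀ os ρ' K j t)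
    hfbA0 hfbB0 hZA0 hZB0 (by positivity) hsbA hsbB hspecB.1 hspecB.2
  -- `Σ shell2 ≤ Mᵃ + Mᵇ` in each run at the selected letters
  have hMA := sum_topGap2ShellAtLevel_le_majorants_of_liveSel θ hP E hsel hζm g₀ os (p := runA₁₃ F K₀ g₀ K) (histA₁₃_zero θ K₀ g₀ K)
    (hθA (i + 1)) (hθA i) (hδ'A (j + 1)) (hδ'A j) t (K₀ + K) rfl
  have hMB := sum_topGap2ShellAtLevel_le_majorants_of_liveSel θ hP E hsel hζm g₀ os (p := runB₁₃ F K₀ g₀ K) (histB₁₃_zero θ K₀ g₀ K)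
    (hθB (i + 1)) (hθB i) (hδ'B (j + 1)) (hδ'B j) t (K₀ + K + 1) rfl
  have hnum : ∀ Z : ℝ, 2 * (2 * X) / ((n₁ + 1 : ℕ) : ℝ) * Z + 2 * (2 * X) / ((n₂ + 1 : ℕ) : ℝ) * Z = 4 * X * (1 / (n₁ + 1 : ℕ) + 1 / (n₂ + 1 : ℕ)) * Z :=
    fun Z => by ring
  have hcardA : (Finset.range (n₁ + 1)).card = n₁ + 1 := Finset.card_range _
  have hcardB : (Finset.range (n₂ + 1)).card = n₂ + 1 := Finset.card_range _
  refine ⟨?_, ?_⟩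
  · calc gap2ShellSumA₁₃ θ hP K₀ g₀ os ρ ρ' K i j t ≤ majA2SumA₁₃ θ hP K₀ g₀ os ρ K i t + majB2SumA₁₃ θ hP K₀ g₀ os ρ' K j t := hMA
      _ ≤ 2 * (2 * X) / ((n₁ + 1 : ℕ) : ℝ) * ZA + 2 * (2 * X) / ((n₂ + 1 : ℕ) : ℝ) * ZA := by
          have h1 : majA2SumA₁₃ θ hP K₀ g₀ os ρ K i t ≤ 2 * (2 * X) / ((n₁ + 1 : ℕ) : ℝ) * ZA := by simpa using haA
          have h2 : majB2SumA₁₃ θ hP K₀ g₀ os ρ' K j t ≤ 2 * (2 * X) / ((n₂ + 1 : ℕ) : ℝ) * ZA := by simpa using hbA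
          linarith
      _ = 4 * X * (1 / (n₁ + 1 : ℕ) + 1 / (n₂ + 1 : ℕ)) * ZA := hnum ZA
  · calc gap2ShellSumB₁₃ θ hP K₀ g₀ os ρ ρ' K i j t ≤ majA2SumB₁₃ θ hP K₀ g₀ os ρ K i t + majB2SumB₁₃ θ hP K₀ g₀ os ρ' K j t := hMB
      _ ≤ 2 * (2 * X) / ((n₁ + 1 : ℕ) : ℝ) * ZB + 2 * (2 * X) / ((n₂ + 1 : ℕ) : ℝ) * ZB := by
          have h1 : majA2SumB₁₃ θ hP K₀ g₀ os ρ K i t ≤ 2 * (2 * X) / ((n₁ + 1 : ℕ) : ℝ) * ZB := by simpa using haB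
          have h2 : majB2SumB₁₃ θ hP K₀ g₀ os ρ' K j t ≤ 2 * (2 * X) / ((n₂ + 1 : ℕ) : ℝ) * ZB := by simpa using hbB
          linarith
      _ = 4 * X * (1 / (n₁ + 1 : ℕ) + 1 / (n₂ + 1 : ℕ)) * ZB := hnum ZB

end AtReading2

end Summit.QuantumFields.YangMills.Theorems.N21GappedTopPair13CoPH

end
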